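import Mathlib
import Summits.MatrixMultiplication.MatrixMultiplication.Theses.ThinBlockAlpha
import Summits.MatrixMultiplication.MatrixMultiplication.Theorems.ThinBlockAlphaRectangularThmBChartSTPP
import Summits.MatrixMultiplication.MatrixMultiplication.Theorems.ThinBlockAlphaBoundedExponentTwoSevenths
import Summits.MatrixMultiplication.MatrixMultiplication.Theorems.RectangularThmB.Negative.NullChart
import Summits.MatrixMultiplication.MatrixMultiplication.Theorems.RectangularThmB.Negative.NullChartEntropy
import Literature.Computability.AlgebraicComplexity.LaserMethodTypeCount

/-! # F3 WITNESS for the rung `ThinThird := ThinRung (1/3)` of crux `ThinBlockAlpha.ThinPackings` (stmt-10595):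
the rung family `ThinRung a` SPECIALISES TO THE PROVED FLOOR `a = 2/7` — `ThinRung (2/7)` from the tree theorem
`Theorems.boundedExponentTwoSevenths_proof` (item stmt-MatrixMultiplication-15152, commit 90cab0bd1f51) by forgetting the
exponent bound; AND the line's certificate format is inhabited there: `trappedTightSeed_twoSevenths : TrappedTightSeed (2/7)`
(the null-offset chart over `ℤ/9`, type `(7,2,7,2)`, assembled from `Theorems/RectangularThmB/Negative/NullChart*.lean`).
No `sorry`.  (Defs copied verbatim from `Lines/thin_third_rung.lean`.) -/

set_option linter.dupNamespace false
noncomputable section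
open Finset
namespace Summit.MatrixMultiplication.MatrixMultiplication.Cruxes.ThinPackings.ThinThirdRungSpecial
open Literature.Computability.AlgebraicComplexity
open Summit.MatrixMultiplication.MatrixMultiplication.Theorems
open Summit.MatrixMultiplication.MatrixMultiplication.Theses
open Summit.MatrixMultiplication.MatrixMultiplication.Theses.ThinBlockAlpha

def ThinSlice (a η : ℝ) : Prop :=
  ∃ (H : Type) (_ : AddCommGroup H) (_ : Fintype H) (L N M : ℕ) (A B C : Fin L → Finset H),
    IsSTPP A B C ∧ (∀ i, (A i).card = N ∧ (B i).card = M ∧ (C i).card = N) ∧ 2 ≤ N ∧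
    (N : ℝ) ^ a ≤ M ∧ (Fintype.card H : ℝ) ≤ L * (N : ℝ) ^ (2 + η)

/-- The `a`-column (rung) of `ThinPackings`: thin designs of shape exponent `a` for EVERY slack `η > 0`. -/
def ThinRung (a : ℝ) : Prop := ∀ η : ℝ, 0 < η → ThinSlice a η

/-- **The next rung**: the `a = 1/3` column of `ThinPackings`. -/
def ThinThird : Prop := ThinRung (1 / 3 : ℝ)


/-- The floor: the `a = 2/7` column of `ThinPackings` holds (witness of weakness for the rung `ThinThird`; the regime
`a = 2/7` is OUTSIDE everything `ω = 2` is known to give constructively — no STPP/design statement follows from S). -/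
theorem thinRung_twoSevenths_special : ThinRung (2 / 7 : ℝ) := by
  obtain ⟨ℓ, hℓ⟩ := boundedExponentTwoSevenths_proof
  intro η hη
  obtain ⟨H, i1, i2, L, N, M, A, B, C, -, hS, hc, hN, hM, hP⟩ := hℓ η hη
  exact ⟨H, i1, i2, L, N, M, A, B, C, hS, hc, hN, hM, hP⟩

example : ThinRung (2 / 7 : ℝ) := thinRung_twoSevenths_special

/-- and every column below the floor. -/
example {a : ℝ} (ha : a ≤ 2 / 7) : ThinRung a := by
  intro η hη
  obtain ⟨H, i1, i2, L, N, M, A, B, C, hS, hc, hN, hM, hP⟩ := thinRung_twoSevenths_special η hη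
  refine ⟨H, i1, i2, L, N, M, A, B, C, hS, hc, hN, le_trans ?_ hM, hP⟩
  have hN1 : (1 : ℝ) ≤ N := by exact_mod_cast le_trans (by norm_num) hN
  exact Real.rpow_le_rpow_of_exponent_le hN1 ha


/-! ## The certificate format is inhabited at the floor: `TrappedTightSeed (2/7)` (the null-offset chart over `ℤ/9`)

The definition below is copied VERBATIM from `Lines/thin_third_rung.lean`; the instance is assembled from the tree files
`Theorems/RectangularThmB/Negative/NullChart.lean` (chart, profiles, Farkas functional, `nullChart_facts`) and
`NullChartEntropy.lean` (support `nullS`, type `nullQ 1 = (7,2,7,2)`, distribution `nullP`, tight labels, marginal entropies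
`1, 1, h₀`, zero penalty).  Numerically: `NA = NC = 7⁷`, `NB = 7² = NA^{2/7}`, `|ℤ/9|^{18} = 9^{18} = NA² · 2^{18 h₀}` EXACTLY. -/

/-- **Trapped tight seed at shape `a`** — the finite certificate behind the floor proof, made generic.  Data: a finite
abelian base `H₀`; a chart `XA XB XC : Fin G → Finset H₀` with per-symbol TPP; profile maps `p₁ p₂ p₃` into
`Fin r₁, Fin r₂, Fin r₃`, injective as a triple, with image the support `S`; a Farkas functional `(f₁, f₂, f₃)` vanishing on
every symbol, nonnegative on solvable patterns and zero only on patterns whose profile triple lies in `S` (TRAPPING); tight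
labels `α β γ` (injective, `α, β` bounded by `b`, summing to zero on `S`); a base type `Q` supported on `S` with
distribution `P = Q / |Q|`; the base block `⟨NA, NB, NC⟩`, `NX = ∏ₓ |XX x|^{Q (profile x)}`, has `NC = NA ≥ 2`,
`NA^a ≤ NB`, and ENTROPY TIGHTNESS `|H₀|^{|Q|} ≤ NA² · 2^{|Q| · (min_m H(P_m) - Γ_S(P))}` with the tree's functionals
(`shannonEntropy`, `marginalDistᵢ`, `maxEntropyPenalty`).  The null-offset chart over `ℤ/9` with `Q = (7,2,7,2)` is such a
seed at `a = 2/7` (Theorems/RectangularThmB/Negative/NullChart*.lean). -/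
def TrappedTightSeed (a : ℝ) : Prop :=
  ∃ (H₀ : Type) (_ : AddCommGroup H₀) (_ : Fintype H₀) (_ : DecidableEq H₀)
    (G r₁ r₂ r₃ k b : ℕ) (XA XB XC : Fin G → Finset H₀)
    (p₁ : Fin G → Fin r₁) (p₂ : Fin G → Fin r₂) (p₃ : Fin G → Fin r₃)
    (f₁ f₂ f₃ : Fin G → ℤ)
    (α : Fin r₁ → Fin k → ℤ) (β : Fin r₂ → Fin k → ℤ) (γ : Fin r₃ → Fin k → ℤ)
    (S : Finset (Fin r₁ × Fin r₂ × Fin r₃)) (Q : Fin r₁ × Fin r₂ × Fin r₃ → ℕ)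
    (P : Fin r₁ × Fin r₂ × Fin r₃ → ℝ),
    -- the chart: per-symbol TPP; symbols are their profile triples; `S` = the set of symbol profiles
    (∀ x, SymbolTPP (XA x) (XB x) (XC x)) ∧
    (Function.Injective fun x => (p₁ x, p₂ x, p₃ x)) ∧
    (∀ x, (p₁ x, p₂ x, p₃ x) ∈ S) ∧ (∀ s ∈ S, ∃ x, (p₁ x, p₂ x, p₃ x) = s) ∧
    -- trapping by a Farkas functional vanishing on every symbol
    (∀ x, f₁ x + f₂ x + f₃ x = 0) ∧
    (∀ x y z, ChartSolvable XA XB XC x y z →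
      0 ≤ f₁ x + f₂ y + f₃ z ∧ (f₁ x + f₂ y + f₃ z = 0 → (p₁ x, p₂ y, p₃ z) ∈ S)) ∧
    -- tight bounded injective labels
    Function.Injective α ∧ Function.Injective β ∧ Function.Injective γ ∧
    (∀ i ρ, |α i ρ| ≤ b) ∧ (∀ j ρ, |β j ρ| ≤ b) ∧
    (∀ s ∈ S, ∀ ρ, α s.1 ρ + β s.2.1 ρ + γ s.2.2 ρ = 0) ∧
    -- the base type `Q` on `S` and its distribution `P = Q / |Q|`
    (∀ s, s ∉ S → Q s = 0) ∧ 0 < ∑ s, Q s ∧ (∀ s, P s = (Q s : ℝ) / ((∑ s, Q s : ℕ) : ℝ)) ∧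
    -- shape and size of the base block `⟨NA, NB, NC⟩`
    (∏ x, (XC x).card ^ Q (p₁ x, p₂ x, p₃ x)) = (∏ x, (XA x).card ^ Q (p₁ x, p₂ x, p₃ x)) ∧
    2 ≤ (∏ x, (XA x).card ^ Q (p₁ x, p₂ x, p₃ x)) ∧
    (((∏ x, (XA x).card ^ Q (p₁ x, p₂ x, p₃ x) : ℕ) : ℝ)) ^ a ≤
      ((∏ x, (XB x).card ^ Q (p₁ x, p₂ x, p₃ x) : ℕ) : ℝ) ∧
    -- entropy tightness: `|H₀|^{|Q|} ≤ NA² · 2^{|Q| (min_m H(P_m) - Γ_S(P))}`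
    (Fintype.card H₀ : ℝ) ^ (∑ s, Q s) ≤
      (((∏ x, (XA x).card ^ Q (p₁ x, p₂ x, p₃ x) : ℕ) : ℝ)) ^ 2 *
        (2 : ℝ) ^ (((∑ s, Q s : ℕ) : ℝ) *
          (min (shannonEntropy (marginalDist₁ P))
              (min (shannonEntropy (marginalDist₂ P)) (shannonEntropy (marginalDist₃ P))) -
            maxEntropyPenalty S P))

open Summit.MatrixMultiplication.MatrixMultiplication.Theorems.RectangularThmB.Negative in
/-- `2^{18 h₀} = 9^{18} / 7^{14}` for `h₀ = log₂ 9 − (7/9) log₂ 7`. -/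
theorem two_rpow_h0 :
    (2 : ℝ) ^ ((18 : ℝ) * (Real.logb 2 9 - 7 / 9 * Real.logb 2 7)) = 9 ^ 18 / 7 ^ 14 := by
  have e : (18 : ℝ) * (Real.logb 2 9 - 7 / 9 * Real.logb 2 7) =
      Real.logb 2 9 * ((18 : ℕ) : ℝ) - Real.logb 2 7 * ((14 : ℕ) : ℝ) := by
    push_cast; ring
  rw [e, Real.rpow_sub (by norm_num : (0 : ℝ) < 2), Real.rpow_mul_natCast (by norm_num : (0 : ℝ) ≤ 2),
    Real.rpow_mul_natCast (by norm_num : (0 : ℝ) ≤ 2),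
    Real.rpow_logb (by norm_num) (by norm_num) (by norm_num),
    Real.rpow_logb (by norm_num) (by norm_num) (by norm_num)]

open Summit.MatrixMultiplication.MatrixMultiplication.Theorems.RectangularThmB.Negative in
/-- **The floor's certificate**: the null-offset chart over `ℤ/9` with type `(7, 2, 7, 2)` is a trapped tight seed of shape
`2/7` — the certificate format `TrappedTightSeed` of the line is inhabited at the proved rung (kernel-checked, no `sorry`). -/
theorem trappedTightSeed_twoSevenths : TrappedTightSeed (2 / 7 : ℝ) := by
  have hA : ∏ x : Fin 4, (nullA x).card ^ nullQ 1 (prof₁ x, prof₂ x, prof₃ x) = 7 ^ 7 := by decide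
  have hB : ∏ x : Fin 4, (nullB x).card ^ nullQ 1 (prof₁ x, prof₂ x, prof₃ x) = 7 ^ 2 := by decide
  have hC : ∏ x : Fin 4, (nullC x).card ^ nullQ 1 (prof₁ x, prof₂ x, prof₃ x) = 7 ^ 7 := by decide
  have hmin : Real.logb 2 9 - 7 / 9 * Real.logb 2 7 ≤
      min (shannonEntropy (marginalDist₁ nullP))
        (min (shannonEntropy (marginalDist₂ nullP)) (shannonEntropy (marginalDist₃ nullP))) -
        maxEntropyPenalty nullS nullP := by
    obtain ⟨h1, h2, h3, hΓ⟩ := nullChart_entropy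
    have := le_min h1 (le_min h2 h3)
    linarith
  refine ⟨ZMod 9, inferInstance, inferInstance, inferInstance, 4, 2, 2, 3, 1, 1, nullA, nullB, nullC,
    prof₁, prof₂, prof₃, farkas₁, farkas₂, farkas₃, labα, labβ, labγ, nullS, nullQ 1, nullP,
    nullChart_facts.1, by decide, by decide, by decide, farkas_sum_symbol, nullChart_facts.2,
    labα_injective, labβ_injective, labγ_injective, ?_, ?_, lab_tight,
    fun s hs => nullQ_eq_zero_of_not_mem 1 s hs, ?_, ?_, ?_, ?_, ?_, ?_⟩
  · intro i ρ
    fin_cases i <;> simp [labα]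
  · intro j ρ
    fin_cases j <;> simp [labβ]
  · rw [sum_nullQ]; norm_num
  · intro s
    rw [sum_nullQ]
    exact nullP_eq_div 1 le_rfl s
  · rw [hC, hA]
  · rw [hA]; norm_num
  · have e : ((7 : ℝ) ^ 7) ^ (2 / 7 : ℝ) = 7 ^ 2 := by
      rw [← Real.rpow_natCast_mul (by norm_num : (0 : ℝ) ≤ 7),
        show ((7 : ℕ) : ℝ) * (2 / 7 : ℝ) = ((2 : ℕ) : ℝ) by norm_num, Real.rpow_natCast]
    rw [hA, hB, Nat.cast_pow, Nat.cast_pow, Nat.cast_ofNat]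
    exact e.le
  · rw [sum_nullQ, hA, ZMod.card]
    have h2 : (2 : ℝ) ^ ((18 : ℝ) * (Real.logb 2 9 - 7 / 9 * Real.logb 2 7)) ≤
        (2 : ℝ) ^ ((((18 * 1 : ℕ)) : ℝ) *
          (min (shannonEntropy (marginalDist₁ nullP))
              (min (shannonEntropy (marginalDist₂ nullP)) (shannonEntropy (marginalDist₃ nullP))) -
            maxEntropyPenalty nullS nullP)) :=
      Real.rpow_le_rpow_of_exponent_le (by norm_num) (by push_cast; nlinarith [hmin])
    rw [two_rpow_h0] at h2
    calc ((9 : ℕ) : ℝ) ^ (18 * 1) = (((7 ^ 7 : ℕ)) : ℝ) ^ 2 * ((9 : ℝ) ^ 18 / 7 ^ 14) := by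
          push_cast; norm_num
      _ ≤ _ := mul_le_mul_of_nonneg_left h2 (by positivity)

/-- Hence the floor rung is ALSO an instance of the line's certificate format (sanity of the typing of
`stub_trappedSeedThird`): format inhabited at `a = 2/7`, asked at `a = 1/3`. -/
example : TrappedTightSeed (2 / 7 : ℝ) := trappedTightSeed_twoSevenths

end Summit.MatrixMultiplication.MatrixMultiplication.Cruxes.ThinPackings.ThinThirdRungSpecial
end
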